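import Literature.Topology.FourManifolds.PlanarArch
import Literature.Analysis.Calculus.SmoothCutoff
import Mathlib.Analysis.Calculus.Deriv.Shift
import HarnessLib

/-!
# Toward the flat birth pair, IV: the explicit profiles

The `1`-dimensional profiles of the explicit Calabi pair (seat notes §F) for the named fact
`Literature.Geometry.Symplectic.flatNearSymplecticTaubesTubes_exists`, with their elementary
properties (exact plateaus, signs of derivatives, supports).  Everything is PROVED.

Vertical profile `ω` (odd, `C^∞`, support `[-5/2, 5/2]`):
`ω = (1 − P₃)((1 − P₁)c + P₁p)` on `x ≥ 0` with `c` the odd quintic matching `p = x² − 3x` to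
second order at `9/10` (`p − c = (x − 9/10)³(125x²/729 + 25x/54)`), `P₁` the smooth step on
`[1/2, 9/10]`, `P₃` the smooth step on `[2, 5/2]`; so `ω = x² − 3x` on `[9/10, 2]` (the exact
germ `F = x + ω = (x − 1)² − 1` around `x = 1`) and `F' = 1 + ω'` is `< 0` on `[0, 1)`, `= 0` at
`1`, `> 0` beyond (a blend of two decreasing functions in the right order keeps the sign of the
derivative — the tree's `exists_blend_deriv_neg` argument).
-/

noncomputable section

open scoped ContDiff Topology
open Set Filter Real
open Literature.Topology.FourManifolds (smoothStep smoothStep_of_le smoothStep_of_ge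
  smoothStep_mem_Icc contDiff_smoothStep differentiable_smoothStep hasDerivAt_smoothStep
  deriv_smoothStep_nonneg deriv_smoothStep_of_lt deriv_smoothStep_of_gt)

namespace Literature.Geometry.Symplectic

/-! ### The vertical profile -/

section Vertical

/-- The odd quintic `c(x) = −(213/80)x + (5/6)x³ − (125/729)x⁵`, matching `x² − 3x` to second
order at `x = 9/10`. [folklore] -/
def quintC (x : ℝ) : ℝ := -(213 / 80) * x + 5 / 6 * x ^ 3 - 125 / 729 * x ^ 5

/-- The saddle parabola `p(x) = x² − 3x` (the germ profile: `x + p = (x − 1)² − 1`). [folklore] -/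
def sadP (x : ℝ) : ℝ := x ^ 2 - 3 * x

/-- **The exact cubic contact**: `p − c = (x − 9/10)³ (125x²/729 + 25x/54)`. [folklore] -/
theorem sadP_sub_quintC (x : ℝ) :
    sadP x - quintC x = (x - 9 / 10) ^ 3 * (125 / 729 * x ^ 2 + 25 / 54 * x) := by
  unfold sadP quintC; ring

/-- `c` is odd. [folklore] -/
theorem quintC_neg (x : ℝ) : quintC (-x) = -quintC x := by unfold quintC; ring

/-- `p ≤ c` on `[0, 9/10]` (the order that makes the blend keep a negative derivative).
[folklore] -/
theorem sadP_le_quintC {x : ℝ} (h0 : 0 ≤ x) (h1 : x ≤ 9 / 10) : sadP x ≤ quintC x := by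
  have h := sadP_sub_quintC x
  have hQ : 0 ≤ 125 / 729 * x ^ 2 + 25 / 54 * x := by positivity
  have hc : (x - 9 / 10) ^ 3 ≤ 0 := by
    have : x - 9 / 10 ≤ 0 := by linarith
    nlinarith [sq_nonneg (x - 9 / 10)]
  nlinarith [mul_nonpos_of_nonpos_of_nonneg hc hQ]

/-- `c' ≤ −6/5` on `[0, 9/10]` (so `1 + c' ≤ −1/5`). [folklore] -/
theorem deriv_quintC_le {x : ℝ} (h0 : 0 ≤ x) (h1 : x ≤ 9 / 10) : deriv quintC x ≤ -(6 / 5) := by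
  have hd : HasDerivAt quintC _ x :=
    (((hasDerivAt_id x).const_mul (-(213 / 80 : ℝ))).fun_add
      ((hasDerivAt_pow 3 x).const_mul (5 / 6 : ℝ))).fun_sub
      ((hasDerivAt_pow 5 x).const_mul (125 / 729 : ℝ))
  rw [hd.deriv]
  norm_num
  have hx2 : x ^ 2 ≤ 81 / 100 := by nlinarith
  nlinarith [sq_nonneg (x ^ 2 - 81 / 100), sq_nonneg x]

/-- `p' = 2x − 3`. [folklore] -/
theorem hasDerivAt_sadP (x : ℝ) : HasDerivAt sadP (2 * x - 3) x := by
  have h : HasDerivAt (fun y : ℝ => y ^ 2 - 3 * y) _ x :=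
    (hasDerivAt_pow 2 x).fun_sub ((hasDerivAt_id x).const_mul (3 : ℝ))
  unfold sadP
  refine h.congr_deriv ?_
  norm_num

/-- `c` is `C^∞`. [folklore] -/
theorem contDiff_quintC : ContDiff ℝ ∞ quintC := by unfold quintC; fun_prop

/-- `p` is `C^∞`. [folklore] -/
theorem contDiff_sadP : ContDiff ℝ ∞ sadP := by unfold sadP; fun_prop

/-- The blend step `P₁` on `[1/2, 9/10]`. [folklore] -/
abbrev stepP1 : ℝ → ℝ := smoothStep (1 / 2) (9 / 10)

/-- The cut step `P₃` on `[2, 5/2]`. [folklore] -/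
abbrev stepP3 : ℝ → ℝ := smoothStep 2 (5 / 2)

/-- **The right half of the vertical profile**:
`ω₊ = (1 − P₃)((1 − P₁)c + P₁ p)`. [folklore] -/
def omegaPlus (x : ℝ) : ℝ :=
  (1 - stepP3 x) * ((1 - stepP1 x) * quintC x + stepP1 x * sadP x)

/-- `Θ = ω₊ − c`, which vanishes on `(-∞, 1/2]`. [folklore] -/
def thetaFn (x : ℝ) : ℝ := omegaPlus x - quintC x

/-- **The vertical profile** `ω = c + Θ − Θ∘(−)`: odd, `= ω₊` on `x ≥ 0`. [folklore] -/
def omegaFn (x : ℝ) : ℝ := quintC x + thetaFn x - thetaFn (-x)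

/-- `ω₊` is `C^∞`. [folklore] -/
theorem contDiff_omegaPlus : ContDiff ℝ ∞ omegaPlus := by
  unfold omegaPlus
  have h1 : ContDiff ℝ ∞ stepP1 := contDiff_smoothStep _ _
  have h3 : ContDiff ℝ ∞ stepP3 := contDiff_smoothStep _ _
  exact (contDiff_const.sub h3).mul
    (((contDiff_const.sub h1).mul contDiff_quintC).add (h1.mul contDiff_sadP))

/-- `Θ` is `C^∞`. [folklore] -/
theorem contDiff_thetaFn : ContDiff ℝ ∞ thetaFn := contDiff_omegaPlus.sub contDiff_quintC

/-- **`ω` is `C^∞`.** [folklore] -/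
theorem contDiff_omegaFn : ContDiff ℝ ∞ omegaFn :=
  (contDiff_quintC.add contDiff_thetaFn).sub (contDiff_thetaFn.comp contDiff_neg)

/-- `ω₊ = c` on `(-∞, 1/2]`. [folklore] -/
theorem omegaPlus_of_le_half {x : ℝ} (hx : x ≤ 1 / 2) : omegaPlus x = quintC x := by
  unfold omegaPlus
  rw [show stepP1 x = 0 from smoothStep_of_le (by norm_num) hx,
    show stepP3 x = 0 from smoothStep_of_le (by norm_num) (by linarith)]
  ring

/-- `Θ = 0` on `(-∞, 1/2]`. [folklore] -/
theorem thetaFn_of_le_half {x : ℝ} (hx : x ≤ 1 / 2) : thetaFn x = 0 := by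
  unfold thetaFn; rw [omegaPlus_of_le_half hx]; ring

/-- `ω = ω₊` on `[0, ∞)`. [folklore] -/
theorem omegaFn_of_nonneg {x : ℝ} (hx : 0 ≤ x) : omegaFn x = omegaPlus x := by
  unfold omegaFn
  rw [thetaFn_of_le_half (by linarith : -x ≤ 1 / 2)]
  unfold thetaFn; ring

/-- `ω = −ω₊∘(−)` on `(-∞, 0]` (oddness). [folklore] -/
theorem omegaFn_of_nonpos {x : ℝ} (hx : x ≤ 0) : omegaFn x = -omegaPlus (-x) := by
  unfold omegaFn
  rw [thetaFn_of_le_half (by linarith : x ≤ 1 / 2)]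
  unfold thetaFn
  rw [quintC_neg]; ring

/-- **`ω` is odd.** [folklore] -/
theorem omegaFn_neg (x : ℝ) : omegaFn (-x) = -omegaFn x := by
  unfold omegaFn; rw [quintC_neg, neg_neg]; ring

/-- **The plateau**: `ω₊ = p = x² − 3x` on `[9/10, 2]`. [folklore] -/
theorem omegaPlus_of_mem_plateau {x : ℝ} (h1 : 9 / 10 ≤ x) (h2 : x ≤ 2) : omegaPlus x = sadP x := by
  unfold omegaPlus
  rw [show stepP1 x = 1 from smoothStep_of_ge (by norm_num) h1,
    show stepP3 x = 0 from smoothStep_of_le (by norm_num) h2]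
  ring

/-- **Compact support**: `ω₊ = 0` on `[5/2, ∞)`. [folklore] -/
theorem omegaPlus_of_ge {x : ℝ} (hx : 5 / 2 ≤ x) : omegaPlus x = 0 := by
  unfold omegaPlus
  rw [show stepP3 x = 1 from smoothStep_of_ge (by norm_num) hx]
  ring

/-- `ω = 0` for `|x| ≥ 5/2`. [folklore] -/
theorem omegaFn_eq_zero {x : ℝ} (hx : 5 / 2 ≤ |x|) : omegaFn x = 0 := by
  rcases le_or_gt 0 x with h | h
  · rw [abs_of_nonneg h] at hx
    rw [omegaFn_of_nonneg h, omegaPlus_of_ge hx]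
  · rw [abs_of_neg h] at hx
    rw [omegaFn_of_nonpos h.le, omegaPlus_of_ge hx, neg_zero]

/-- On `(2, ∞)`: `ω₊ = (1 − P₃)p`. [folklore] -/
theorem omegaPlus_of_two_le {x : ℝ} (hx : 9 / 10 ≤ x) : omegaPlus x = (1 - stepP3 x) * sadP x := by
  unfold omegaPlus
  rw [show stepP1 x = 1 from smoothStep_of_ge (by norm_num) hx]
  ring

/-- **The derivative of `ω₊` on the blend** `[0, 9/10]` is `≤ −6/5`: there `ω₊ = (1 − P₁)c + P₁p`,
`ω₊' = (1 − P₁)c' + P₁p' + P₁'(p − c)` with `c', p' ≤ −6/5`, `P₁' ≥ 0`, `p − c ≤ 0`. [folklore] -/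
theorem deriv_omegaPlus_le_of_mem_blend {x : ℝ} (h0 : 0 ≤ x) (h1 : x ≤ 9 / 10) :
    deriv omegaPlus x ≤ -(6 / 5) := by
  -- near x, P₃ = 0 so ω₊ = (1 - P₁)c + P₁ p
  have hloc : omegaPlus =ᶠ[𝓝 x] fun y => (1 - stepP1 y) * quintC y + stepP1 y * sadP y := by
    have : Iio (2 : ℝ) ∈ 𝓝 x := Iio_mem_nhds (by linarith)
    filter_upwards [this] with y hy
    unfold omegaPlus
    rw [show stepP3 y = 0 from smoothStep_of_le (by norm_num) (le_of_lt hy)]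
    ring
  rw [hloc.deriv_eq]
  have hP := (differentiable_smoothStep (1 / 2) (9 / 10) x).hasDerivAt
  have hc := (contDiff_quintC.differentiable (by simp) x).hasDerivAt
  have hp := hasDerivAt_sadP x
  have hd := ((hP.const_sub 1).fun_mul hc).fun_add (hP.fun_mul hp)
  rw [hd.deriv]
  have hP0 : 0 ≤ stepP1 x := (smoothStep_mem_Icc _ _ x).1
  have hP1 : stepP1 x ≤ 1 := (smoothStep_mem_Icc _ _ x).2
  have hP' : 0 ≤ deriv stepP1 x := deriv_smoothStep_nonneg (by norm_num) x
  have hc' : deriv quintC x ≤ -(6 / 5) := deriv_quintC_le h0 h1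
  have hp' : 2 * x - 3 ≤ -(6 / 5) := by linarith
  have hpc : sadP x - quintC x ≤ 0 := by linarith [sadP_le_quintC h0 h1]
  have : -deriv stepP1 x * quintC x + (1 - stepP1 x) * deriv quintC x +
      (deriv stepP1 x * sadP x + stepP1 x * (2 * x - 3)) =
      (1 - stepP1 x) * deriv quintC x + stepP1 x * (2 * x - 3) +
        deriv stepP1 x * (sadP x - quintC x) := by ring
  rw [this]
  nlinarith [mul_nonneg hP' (by linarith : (0:ℝ) ≤ -(sadP x - quintC x)),
    mul_le_mul_of_nonneg_left hc' (by linarith : (0:ℝ) ≤ 1 - stepP1 x),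
    mul_le_mul_of_nonneg_left hp' hP0]

/-- **The derivative of `ω₊` on the plateau** `(9/10, 2)`: `ω₊' = 2x − 3`. [folklore] -/
theorem hasDerivAt_omegaPlus_plateau {x : ℝ} (h1 : 9 / 10 < x) (h2 : x < 2) :
    HasDerivAt omegaPlus (2 * x - 3) x := by
  have hloc : omegaPlus =ᶠ[𝓝 x] sadP := by
    filter_upwards [Ioo_mem_nhds h1 h2] with y hy
    exact omegaPlus_of_mem_plateau hy.1.le hy.2.le
  exact (hasDerivAt_sadP x).congr_of_eventuallyEq hloc

/-- **The derivative of `ω₊` beyond the plateau** `[2, ∞)` is `≥ 0`: there `ω₊ = (1 − P₃)p` with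
`p ≤ 0`, `p' ≥ 0`, `P₃' ≥ 0`. [folklore] -/
theorem deriv_omegaPlus_nonneg_of_two_le {x : ℝ} (hx : 2 ≤ x) : 0 ≤ deriv omegaPlus x := by
  rcases le_or_gt x 3 with h3 | h3
  · have hloc : omegaPlus =ᶠ[𝓝 x] fun y => (1 - stepP3 y) * sadP y := by
      filter_upwards [Ioi_mem_nhds (by linarith : (9:ℝ) / 10 < x)] with y hy
      exact omegaPlus_of_two_le (le_of_lt hy)
    rw [hloc.deriv_eq]
    have hP := (differentiable_smoothStep 2 (5 / 2) x).hasDerivAt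
    have hd := (hP.const_sub 1).fun_mul (hasDerivAt_sadP x)
    rw [hd.deriv]
    have hP1 : stepP3 x ≤ 1 := (smoothStep_mem_Icc _ _ x).2
    have hP' : 0 ≤ deriv stepP3 x := deriv_smoothStep_nonneg (by norm_num) x
    have hp : sadP x ≤ 0 := by unfold sadP; nlinarith
    have hp' : 0 ≤ 2 * x - 3 := by linarith
    nlinarith [mul_nonneg hP' (by linarith : (0:ℝ) ≤ -sadP x), mul_nonneg (by linarith : (0:ℝ) ≤ 1 - stepP3 x) hp']
  · have hloc : omegaPlus =ᶠ[𝓝 x] fun _ => 0 := by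
      filter_upwards [Ioi_mem_nhds (by linarith : (5:ℝ) / 2 < x)] with y hy
      exact omegaPlus_of_ge (le_of_lt hy)
    rw [hloc.deriv_eq, deriv_const]

/-- **Sign pattern of `F' = 1 + ω'` on `[0, ∞)`**: `F'(x) = 0` forces `x = 1`. [folklore] -/
theorem eq_one_of_deriv_omegaPlus {x : ℝ} (hx : 0 ≤ x) (h : 1 + deriv omegaPlus x = 0) : x = 1 := by
  rcases le_or_gt x (9 / 10) with h1 | h1
  · have := deriv_omegaPlus_le_of_mem_blend hx h1; linarith
  rcases lt_or_ge x 2 with h2 | h2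
  · rw [(hasDerivAt_omegaPlus_plateau h1 h2).deriv] at h; linarith
  · have := deriv_omegaPlus_nonneg_of_two_le h2; linarith

/-- The derivative of `ω` on `[0, ∞)` is that of `ω₊` (for `x > 0` by local equality, at `0`
because `ω = c` near `0`). [folklore] -/
theorem deriv_omegaFn_of_nonneg {x : ℝ} (hx : 0 ≤ x) : deriv omegaFn x = deriv omegaPlus x := by
  rcases hx.lt_or_eq with hpos | hzero
  · have hloc : omegaFn =ᶠ[𝓝 x] omegaPlus := by
      filter_upwards [Ioi_mem_nhds hpos] with y hy
      exact omegaFn_of_nonneg (le_of_lt hy)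
    exact hloc.deriv_eq
  · subst hzero
    have h1 : omegaFn =ᶠ[𝓝 (0:ℝ)] quintC := by
      filter_upwards [Ioo_mem_nhds (by norm_num : -(1:ℝ)/2 < 0) (by norm_num : (0:ℝ) < 1/2)]
        with y hy
      unfold omegaFn
      rw [thetaFn_of_le_half hy.2.le, thetaFn_of_le_half (by linarith [hy.1] : -y ≤ 1 / 2)]
      ring
    have h2 : omegaPlus =ᶠ[𝓝 (0:ℝ)] quintC := by
      filter_upwards [Iio_mem_nhds (by norm_num : (0:ℝ) < 1/2)] with y hy
      exact omegaPlus_of_le_half hy.le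
    rw [h1.deriv_eq, h2.deriv_eq]

/-- The derivative of `ω` on `(-∞, 0]`: `ω'(x) = ω₊'(−x)` (oddness). [folklore] -/
theorem deriv_omegaFn_of_nonpos {x : ℝ} (hx : x ≤ 0) : deriv omegaFn x = deriv omegaPlus (-x) := by
  have hodd : omegaFn = fun y => -omegaFn (-y) := by
    funext y; rw [omegaFn_neg, neg_neg]
  have h1 : deriv omegaFn x = deriv (fun y => -omegaFn (-y)) x := by rw [← hodd]
  rw [h1, deriv.fun_neg, deriv_comp_neg, neg_neg, deriv_omegaFn_of_nonneg (by linarith : 0 ≤ -x)]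

/-- **`F' = 1 + ω'` vanishes exactly at `±1`.** [folklore] -/
theorem one_add_deriv_omegaFn_eq_zero_iff (x : ℝ) :
    1 + deriv omegaFn x = 0 ↔ x = 1 ∨ x = -1 := by
  constructor
  · intro h
    rcases le_or_gt 0 x with hx | hx
    · rw [deriv_omegaFn_of_nonneg hx] at h
      exact Or.inl (eq_one_of_deriv_omegaPlus hx h)
    · rw [deriv_omegaFn_of_nonpos hx.le] at h
      have := eq_one_of_deriv_omegaPlus (by linarith) h
      exact Or.inr (by linarith)
  · rintro (rfl | rfl)
    · rw [deriv_omegaFn_of_nonneg zero_le_one,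
        (hasDerivAt_omegaPlus_plateau (by norm_num) (by norm_num)).deriv]; norm_num
    · rw [deriv_omegaFn_of_nonpos (by norm_num), neg_neg,
        (hasDerivAt_omegaPlus_plateau (by norm_num) (by norm_num)).deriv]; norm_num

/-- **The exact germ at `+1`**: `ω = x² − 3x` on `[9/10, 2]`. [folklore] -/
theorem omegaFn_of_mem_plateau {x : ℝ} (h1 : 9 / 10 ≤ x) (h2 : x ≤ 2) : omegaFn x = x ^ 2 - 3 * x := by
  rw [omegaFn_of_nonneg (by linarith), omegaPlus_of_mem_plateau h1 h2]; rfl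

/-- **The exact germ at `−1`**: `ω = −x² − 3x` on `[−2, −9/10]`. [folklore] -/
theorem omegaFn_of_mem_plateau_neg {x : ℝ} (h1 : -2 ≤ x) (h2 : x ≤ -(9 / 10)) :
    omegaFn x = -x ^ 2 - 3 * x := by
  rw [omegaFn_of_nonpos (by linarith), omegaPlus_of_mem_plateau (by linarith) (by linarith)]
  unfold sadP; ring

/-- Near a point of the open plateau `(9/10, 2)`, `ω' = 2x − 3` as functions. [folklore] -/
theorem deriv_omegaFn_eventuallyEq_plateau {x : ℝ} (h1 : 9 / 10 < x) (h2 : x < 2) :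
    deriv omegaFn =ᶠ[𝓝 x] fun y => 2 * y - 3 := by
  filter_upwards [Ioo_mem_nhds h1 h2] with y hy
  rw [deriv_omegaFn_of_nonneg (by linarith [hy.1]), (hasDerivAt_omegaPlus_plateau hy.1 hy.2).deriv]

/-- On the open plateau `(9/10, 2)`: `ω' = 2x − 3`. [folklore] -/
theorem deriv_omegaFn_plateau {x : ℝ} (h1 : 9 / 10 < x) (h2 : x < 2) : deriv omegaFn x = 2 * x - 3 :=
  (deriv_omegaFn_eventuallyEq_plateau h1 h2).self_of_nhds

/-- On the open plateau `(9/10, 2)`: `ω'' = 2`. [folklore] -/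
theorem deriv2_omegaFn_plateau {x : ℝ} (h1 : 9 / 10 < x) (h2 : x < 2) : deriv (deriv omegaFn) x = 2 := by
  rw [(deriv_omegaFn_eventuallyEq_plateau h1 h2).deriv_eq]
  have h : HasDerivAt (fun y : ℝ => 2 * y - 3) _ x := ((hasDerivAt_id x).const_mul (2:ℝ)).sub_const 3
  rw [h.deriv]; simp

/-- Near a point of the negative plateau `(−2, −9/10)`, `ω' = −2x − 3`. [folklore] -/
theorem deriv_omegaFn_eventuallyEq_plateau_neg {x : ℝ} (h1 : -2 < x) (h2 : x < -(9 / 10)) :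
    deriv omegaFn =ᶠ[𝓝 x] fun y => -2 * y - 3 := by
  filter_upwards [Ioo_mem_nhds h1 h2] with y hy
  rw [deriv_omegaFn_of_nonpos (by linarith [hy.2]),
    (hasDerivAt_omegaPlus_plateau (by linarith [hy.2]) (by linarith [hy.1])).deriv]
  ring

/-- On `(−2, −9/10)`: `ω' = −2x − 3`. [folklore] -/
theorem deriv_omegaFn_plateau_neg {x : ℝ} (h1 : -2 < x) (h2 : x < -(9 / 10)) :
    deriv omegaFn x = -2 * x - 3 :=
  (deriv_omegaFn_eventuallyEq_plateau_neg h1 h2).self_of_nhds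

/-- On `(−2, −9/10)`: `ω'' = −2`. [folklore] -/
theorem deriv2_omegaFn_plateau_neg {x : ℝ} (h1 : -2 < x) (h2 : x < -(9 / 10)) :
    deriv (deriv omegaFn) x = -2 := by
  rw [(deriv_omegaFn_eventuallyEq_plateau_neg h1 h2).deriv_eq]
  have h : HasDerivAt (fun y : ℝ => -2 * y - 3) _ x := ((hasDerivAt_id x).const_mul (-2:ℝ)).sub_const 3
  rw [h.deriv]; simp

/-- Outside `[-5/2, 5/2]` (strictly), `ω` vanishes near the point. [folklore] -/
theorem omegaFn_eventuallyEq_zero {x : ℝ} (hx : 5 / 2 < |x|) : omegaFn =ᶠ[𝓝 x] fun _ => 0 := by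
  have hopen : IsOpen {y : ℝ | 5 / 2 < |y|} := isOpen_lt continuous_const continuous_abs
  filter_upwards [hopen.mem_nhds hx] with y hy
  exact omegaFn_eq_zero (le_of_lt hy)

/-- `ω' = 0` strictly outside `[-5/2, 5/2]`. [folklore] -/
theorem deriv_omegaFn_eq_zero {x : ℝ} (hx : 5 / 2 < |x|) : deriv omegaFn x = 0 := by
  rw [(omegaFn_eventuallyEq_zero hx).deriv_eq, deriv_const]

/-- `ω'` vanishes near every point strictly outside `[-5/2, 5/2]`. [folklore] -/
theorem deriv_omegaFn_eventuallyEq_zero {x : ℝ} (hx : 5 / 2 < |x|) :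
    deriv omegaFn =ᶠ[𝓝 x] fun _ => 0 := by
  have hopen : IsOpen {y : ℝ | 5 / 2 < |y|} := isOpen_lt continuous_const continuous_abs
  filter_upwards [hopen.mem_nhds hx] with y hy
  exact deriv_omegaFn_eq_zero hy

/-- `ω'' = 0` strictly outside `[-5/2, 5/2]`. [folklore] -/
theorem deriv2_omegaFn_eq_zero {x : ℝ} (hx : 5 / 2 < |x|) : deriv (deriv omegaFn) x = 0 := by
  rw [(deriv_omegaFn_eventuallyEq_zero hx).deriv_eq, deriv_const]

/-- `ω'` is `C^∞`. [folklore] -/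
theorem contDiff_deriv_omegaFn : ContDiff ℝ ∞ (deriv omegaFn) :=
  contDiff_omegaFn.deriv'

/-- `ω''` is `C^∞`. [folklore] -/
theorem contDiff_deriv2_omegaFn : ContDiff ℝ ∞ (deriv (deriv omegaFn)) :=
  contDiff_deriv_omegaFn.deriv'

/-- A continuous function vanishing outside `[-a, a]` is bounded. [folklore] -/
theorem exists_abs_le_of_eq_zero_of_lt {f : ℝ → ℝ} (hf : Continuous f) {a : ℝ}
    (h0 : ∀ x, a < |x| → f x = 0) : ∃ C : ℝ, 0 ≤ C ∧ ∀ x, |f x| ≤ C := by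
  obtain ⟨C, hC⟩ := (isCompact_Icc (a := -a) (b := a)).exists_bound_of_continuousOn hf.continuousOn
  refine ⟨max C 0, le_max_right _ _, fun x => ?_⟩
  by_cases hx : a < |x|
  · rw [h0 x hx, abs_zero]; exact le_max_right _ _
  · have hmem : x ∈ Icc (-a) a := by
      rw [not_lt] at hx; exact ⟨by linarith [neg_abs_le x], le_trans (le_abs_self x) hx⟩
    have := hC x hmem
    rw [Real.norm_eq_abs] at this
    exact this.trans (le_max_left _ _)

/-- **Sup bounds of the vertical profile**: `|ω| ≤ Ω₀`, `|ω'| ≤ Ω₁`, `|ω''| ≤ Ω₂`. [folklore] -/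
theorem exists_bounds_omegaFn : ∃ Ω₀ Ω₁ Ω₂ : ℝ, 0 ≤ Ω₀ ∧ 0 ≤ Ω₁ ∧ 0 ≤ Ω₂ ∧
    (∀ x, |omegaFn x| ≤ Ω₀) ∧ (∀ x, |deriv omegaFn x| ≤ Ω₁) ∧ (∀ x, |deriv (deriv omegaFn) x| ≤ Ω₂) := by
  obtain ⟨A, hA0, hA⟩ := exists_abs_le_of_eq_zero_of_lt contDiff_omegaFn.continuous
    (fun x hx => omegaFn_eq_zero (le_of_lt hx))
  obtain ⟨B, hB0, hB⟩ := exists_abs_le_of_eq_zero_of_lt contDiff_deriv_omegaFn.continuous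
    (fun x hx => deriv_omegaFn_eq_zero hx)
  obtain ⟨C, hC0, hC⟩ := exists_abs_le_of_eq_zero_of_lt contDiff_deriv2_omegaFn.continuous
    (fun x hx => deriv2_omegaFn_eq_zero hx)
  exact ⟨A, B, C, hA0, hB0, hC0, hA, hB, hC⟩

/-! ### The bump `b`, the strain `β = (ω'')²/2 + b` and the taper `σ` -/

/-- The even bump `b(x) = 1 − step₃⁴(x) − step₃⁴(−x)`: `= 1` on `[-3, 3]`, `= 0` for `|x| ≥ 4`,
values in `[0, 1]`. [folklore] -/
def bumpB (x : ℝ) : ℝ := 1 - smoothStep 3 4 x - smoothStep 3 4 (-x)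

/-- `b` is `C^∞`. [folklore] -/
theorem contDiff_bumpB : ContDiff ℝ ∞ bumpB := by
  unfold bumpB
  exact (contDiff_const.sub (contDiff_smoothStep 3 4)).sub ((contDiff_smoothStep 3 4).comp contDiff_neg)

/-- `b = 1` on `[-3, 3]`. [folklore] -/
theorem bumpB_of_abs_le {x : ℝ} (hx : |x| ≤ 3) : bumpB x = 1 := by
  unfold bumpB
  rw [smoothStep_of_le (by norm_num) (le_trans (le_abs_self x) hx),
    smoothStep_of_le (by norm_num) (le_trans (neg_le_abs x) hx)]
  ring

/-- `b = 0` for `|x| ≥ 4`. [folklore] -/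
theorem bumpB_of_le_abs {x : ℝ} (hx : 4 ≤ |x|) : bumpB x = 0 := by
  unfold bumpB
  rcases le_or_gt 0 x with h | h
  · rw [abs_of_nonneg h] at hx
    rw [smoothStep_of_ge (by norm_num) hx, smoothStep_of_le (by norm_num) (by linarith)]; ring
  · rw [abs_of_neg h] at hx
    rw [smoothStep_of_le (by norm_num) (by linarith), smoothStep_of_ge (by norm_num) hx]; ring

/-- `0 ≤ b ≤ 1` (at most one of the two steps is nonzero). [folklore] -/
theorem bumpB_mem_Icc (x : ℝ) : bumpB x ∈ Icc 0 1 := by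
  unfold bumpB
  have h1 := smoothStep_mem_Icc 3 4 x
  have h2 := smoothStep_mem_Icc 3 4 (-x)
  rcases le_or_gt 0 x with h | h
  · rw [smoothStep_of_le (a := 3) (b := 4) (by norm_num) (by linarith : -x ≤ 3)]
    constructor <;> linarith [h1.1, h1.2]
  · rw [smoothStep_of_le (a := 3) (b := 4) (by norm_num) (by linarith : x ≤ 3)]
    constructor <;> linarith [h2.1, h2.2]

/-- **The strain profile** `β = (ω'')²/2 + b`. [folklore] -/
def betaFn (x : ℝ) : ℝ := (deriv (deriv omegaFn) x) ^ 2 / 2 + bumpB x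

/-- `β` is `C^∞`. [folklore] -/
theorem contDiff_betaFn : ContDiff ℝ ∞ betaFn := by
  unfold betaFn
  exact ((contDiff_deriv2_omegaFn.pow 2).div_const 2).add contDiff_bumpB

/-- `β ≥ 0`. [folklore] -/
theorem betaFn_nonneg (x : ℝ) : 0 ≤ betaFn x := by
  unfold betaFn; have := (bumpB_mem_Icc x).1; positivity

/-- **`m, n ≥ 7/16` on the slab** `|x| ≤ 3`: `2·(7/16) ≤ β ∓ ω''/2` (AM–GM with `b = 1`). [folklore] -/
theorem betaFn_sub_ge {x : ℝ} (hx : |x| ≤ 3) :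
    2 * (7 / 16 : ℝ) ≤ betaFn x - deriv (deriv omegaFn) x / 2 ∧
      2 * (7 / 16 : ℝ) ≤ betaFn x + deriv (deriv omegaFn) x / 2 := by
  unfold betaFn; rw [bumpB_of_abs_le hx]
  constructor <;> nlinarith [sq_nonneg (deriv (deriv omegaFn) x - 1 / 2),
    sq_nonneg (deriv (deriv omegaFn) x + 1 / 2)]

/-- Off the support of `ω` (`|x| > 5/2`): `β = b ∈ [0, 1]`. [folklore] -/
theorem betaFn_of_lt_abs {x : ℝ} (hx : 5 / 2 < |x|) : betaFn x = bumpB x := by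
  unfold betaFn; rw [deriv2_omegaFn_eq_zero hx]; ring

/-- `β = 0` for `|x| ≥ 4`. [folklore] -/
theorem betaFn_of_le_abs {x : ℝ} (hx : 4 ≤ |x|) : betaFn x = 0 := by
  rw [betaFn_of_lt_abs (by linarith), bumpB_of_le_abs hx]

/-- `β = 3` on the open plateaus `9/10 < |x| < 2` (where `ω'' = ±2`, `b = 1`). [folklore] -/
theorem betaFn_plateau {x : ℝ} (h1 : 9 / 10 < x) (h2 : x < 2) : betaFn x = 3 := by
  unfold betaFn
  rw [deriv2_omegaFn_plateau h1 h2, bumpB_of_abs_le (by rw [abs_of_pos (by linarith)]; linarith)]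
  norm_num

/-- `β = 3` on the negative plateau. [folklore] -/
theorem betaFn_plateau_neg {x : ℝ} (h1 : -2 < x) (h2 : x < -(9 / 10)) : betaFn x = 3 := by
  unfold betaFn
  rw [deriv2_omegaFn_plateau_neg h1 h2, bumpB_of_abs_le (by rw [abs_of_neg (by linarith)]; linarith)]
  norm_num

/-- **Sup bound of `β`.** [folklore] -/
theorem exists_bound_betaFn : ∃ βm : ℝ, 0 ≤ βm ∧ ∀ x, betaFn x ≤ βm := by
  obtain ⟨_, _, Ω₂, _, _, hΩ₂, _, _, h2⟩ := exists_bounds_omegaFn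
  refine ⟨Ω₂ ^ 2 / 2 + 1, by positivity, fun x => ?_⟩
  unfold betaFn
  have hb := (bumpB_mem_Icc x).2
  have hsq : (deriv (deriv omegaFn) x) ^ 2 ≤ Ω₂ ^ 2 := by
    have := h2 x
    rw [← sq_abs]; exact pow_le_pow_left₀ (abs_nonneg _) this 2
  linarith

/-- **The taper** `σ_{X,L}(x) = 1 − step_X^{X+L}(x) − step_X^{X+L}(−x)`: `= 1` on `[-X, X]`, `= 0` for
`|x| ≥ X + L`. [folklore] -/
def sigmaFn (X L x : ℝ) : ℝ := 1 - smoothStep X (X + L) x - smoothStep X (X + L) (-x)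

/-- `σ` is `C^∞`. [folklore] -/
theorem contDiff_sigmaFn (X L : ℝ) : ContDiff ℝ ∞ (sigmaFn X L) := by
  unfold sigmaFn
  exact (contDiff_const.sub (contDiff_smoothStep _ _)).sub ((contDiff_smoothStep _ _).comp contDiff_neg)

/-- `σ = 1` on `[-X, X]` (`L > 0`). [folklore] -/
theorem sigmaFn_of_abs_le {X L x : ℝ} (hL : 0 < L) (hx : |x| ≤ X) : sigmaFn X L x = 1 := by
  unfold sigmaFn
  rw [smoothStep_of_le (by linarith) (le_trans (le_abs_self x) hx),
    smoothStep_of_le (by linarith) (le_trans (neg_le_abs x) hx)]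
  ring

/-- Near a point with `|x| < X`, `σ = 1` identically; hence `σ' = 0` there. [folklore] -/
theorem deriv_sigmaFn_of_abs_lt {X L x : ℝ} (hL : 0 < L) (hx : |x| < X) : deriv (sigmaFn X L) x = 0 := by
  have hloc : sigmaFn X L =ᶠ[𝓝 x] fun _ => 1 := by
    have hopen : IsOpen {y : ℝ | |y| < X} := isOpen_lt continuous_abs continuous_const
    filter_upwards [hopen.mem_nhds hx] with y hy
    exact sigmaFn_of_abs_le hL hy.le
  rw [hloc.deriv_eq, deriv_const]

/-- `σ = 0` for `|x| ≥ X + L` (`0 ≤ X`, `0 < L`). [folklore] -/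
theorem sigmaFn_of_le_abs {X L x : ℝ} (hX : 0 ≤ X) (hL : 0 < L) (hx : X + L ≤ |x|) :
    sigmaFn X L x = 0 := by
  unfold sigmaFn
  rcases le_or_gt 0 x with h | h
  · rw [abs_of_nonneg h] at hx
    rw [smoothStep_of_ge (by linarith) hx, smoothStep_of_le (by linarith) (by linarith)]; ring
  · rw [abs_of_neg h] at hx
    rw [smoothStep_of_le (by linarith) (by linarith), smoothStep_of_ge (by linarith) hx]; ring

/-- The derivative of `σ`: `σ' = −step'(x) + step'(−x)`. [folklore] -/
theorem hasDerivAt_sigmaFn (X L x : ℝ) :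
    HasDerivAt (sigmaFn X L)
      (-deriv (smoothStep X (X + L)) x + deriv (smoothStep X (X + L)) (-x)) x := by
  have h1 := (differentiable_smoothStep X (X + L) x).hasDerivAt
  have h2 := (differentiable_smoothStep X (X + L) (-x)).hasDerivAt
  have h : HasDerivAt (sigmaFn X L) _ x := (h1.const_sub 1).fun_sub (h2.comp x (hasDerivAt_neg x))
  refine h.congr_deriv ?_
  ring

end Vertical

/-! ### A uniform bound for the derivative of smooth steps -/

section StepBound

/-- A bound `D_b ≥ 0` of `|smoothTransition'|` (from the tree's
`Literature.Analysis.Calculus.exists_bound_deriv_smoothTransition`). [folklore] -/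
def stepD : ℝ := Classical.choose Literature.Analysis.Calculus.exists_bound_deriv_smoothTransition

/-- `0 ≤ D_b`. [folklore] -/
theorem stepD_nonneg : 0 ≤ stepD :=
  (Classical.choose_spec Literature.Analysis.Calculus.exists_bound_deriv_smoothTransition).1

/-- `|smoothTransition' t| ≤ D_b`. [folklore] -/
theorem abs_deriv_smoothTransition_le_stepD (t : ℝ) : |deriv smoothTransition t| ≤ stepD :=
  (Classical.choose_spec Literature.Analysis.Calculus.exists_bound_deriv_smoothTransition).2 t

/-- **`|(smoothStep a b)'| ≤ D_b/(b − a)`** for `a < b`. [folklore] -/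
theorem abs_deriv_smoothStep_le_stepD {a b : ℝ} (hab : a < b) (x : ℝ) :
    |deriv (smoothStep a b) x| ≤ stepD / (b - a) := by
  rw [(hasDerivAt_smoothStep a b x).deriv, abs_mul, abs_of_pos (inv_pos.2 (sub_pos.2 hab)),
    div_eq_mul_inv]
  exact mul_le_mul_of_nonneg_right (abs_deriv_smoothTransition_le_stepD _) (inv_nonneg.2 (by linarith))

/-- `|σ'| ≤ D_b/L` (at most one of the two steps has nonzero derivative at any point, `X ≥ 0`).
[folklore] -/
theorem abs_deriv_sigmaFn_le {X L : ℝ} (hX : 0 ≤ X) (hL : 0 < L) (x : ℝ) :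
    |deriv (sigmaFn X L) x| ≤ stepD / L := by
  rw [(hasDerivAt_sigmaFn X L x).deriv]
  have hXL : X < X + L := by linarith
  have hb := abs_deriv_smoothStep_le_stepD hXL
  rw [show X + L - X = L by ring] at hb
  rcases le_or_gt 0 x with h | h
  · -- the reflected step is constant near -x ≤ 0 ≤ X unless X = 0 = x; use the derivative at -x
    rcases (show -x < X ∨ -x = X by rcases lt_or_eq_of_le (by linarith : -x ≤ X) with h' | h' <;> tauto)
      with hlt | heq
    · rw [deriv_smoothStep_of_lt hXL hlt, add_zero, abs_neg]; exact hb x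
    · have hx0 : x = 0 := by linarith
      subst hx0
      have hX0 : X = 0 := by linarith
      subst hX0
      simp only [neg_zero]
      rw [show -deriv (smoothStep 0 (0 + L)) 0 + deriv (smoothStep 0 (0 + L)) 0 = 0 by ring, abs_zero]
      exact div_nonneg stepD_nonneg hL.le
  · rw [deriv_smoothStep_of_lt hXL (by linarith : x < X), neg_zero, zero_add]; exact hb (-x)

end StepBound

/-! ### The radial profiles (functions of `r = ρ²`) -/

section Radial

variable {r₀ ΔA rA ΔG rB rC rE ΔE : ℝ}

/-- The core cut-off `χ(r) = 1 − step_{r₀}^{r₀+Δ_A}(r)`. [folklore] -/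
def chiR (r₀ ΔA r : ℝ) : ℝ := 1 - smoothStep r₀ (r₀ + ΔA) r

/-- `χ` is `C^∞`. [folklore] -/
theorem contDiff_chiR (r₀ ΔA : ℝ) : ContDiff ℝ ∞ (chiR r₀ ΔA) :=
  contDiff_const.sub (contDiff_smoothStep _ _)

/-- `χ ∈ [0, 1]`. [folklore] -/
theorem chiR_mem_Icc (r₀ ΔA r : ℝ) : chiR r₀ ΔA r ∈ Icc 0 1 := by
  unfold chiR; have h := smoothStep_mem_Icc r₀ (r₀ + ΔA) r
  constructor <;> linarith [h.1, h.2]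

/-- `χ = 1` on `(-∞, r₀]` (`Δ_A > 0`). [folklore] -/
theorem chiR_of_le (hΔ : 0 < ΔA) {r : ℝ} (hr : r ≤ r₀) : chiR r₀ ΔA r = 1 := by
  unfold chiR; rw [smoothStep_of_le (by linarith) hr]; ring

/-- `χ = 0` on `[r₀ + Δ_A, ∞)`. [folklore] -/
theorem chiR_of_ge (hΔ : 0 < ΔA) {r : ℝ} (hr : r₀ + ΔA ≤ r) : chiR r₀ ΔA r = 0 := by
  unfold chiR; rw [smoothStep_of_ge (by linarith) hr]; ring

/-- `χ' = −step'`. [folklore] -/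
theorem hasDerivAt_chiR (r₀ ΔA r : ℝ) :
    HasDerivAt (chiR r₀ ΔA) (-deriv (smoothStep r₀ (r₀ + ΔA)) r) r := by
  unfold chiR
  simpa using ((differentiable_smoothStep r₀ (r₀ + ΔA) r).hasDerivAt).const_sub 1

/-- `χ' = 0` near a point `r < r₀`. [folklore] -/
theorem deriv_chiR_of_lt (hΔ : 0 < ΔA) {r : ℝ} (hr : r < r₀) : deriv (chiR r₀ ΔA) r = 0 := by
  rw [(hasDerivAt_chiR r₀ ΔA r).deriv, deriv_smoothStep_of_lt (by linarith) hr, neg_zero]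

/-- `χ' = 0` beyond `r₀ + Δ_A`. [folklore] -/
theorem deriv_chiR_of_gt (hΔ : 0 < ΔA) {r : ℝ} (hr : r₀ + ΔA < r) : deriv (chiR r₀ ΔA) r = 0 := by
  rw [(hasDerivAt_chiR r₀ ΔA r).deriv, deriv_smoothStep_of_gt (by linarith) hr, neg_zero]

/-- `|χ'| ≤ D_b/Δ_A`. [folklore] -/
theorem abs_deriv_chiR_le (hΔ : 0 < ΔA) (r : ℝ) : |deriv (chiR r₀ ΔA) r| ≤ stepD / ΔA := by
  rw [(hasDerivAt_chiR r₀ ΔA r).deriv, abs_neg]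
  have := abs_deriv_smoothStep_le_stepD (show r₀ < r₀ + ΔA by linarith) r
  rwa [show r₀ + ΔA - r₀ = ΔA by ring] at this

/-- The moat profile `H(r) = (1 − step_{r_A}^{r_A+Δ_G}(r))/2`. [folklore] -/
def moatH (rA ΔG r : ℝ) : ℝ := (1 - smoothStep rA (rA + ΔG) r) / 2

/-- `H` is `C^∞`. [folklore] -/
theorem contDiff_moatH (rA ΔG : ℝ) : ContDiff ℝ ∞ (moatH rA ΔG) :=
  (contDiff_const.sub (contDiff_smoothStep _ _)).div_const _

/-- `H ∈ [0, 1/2]`. [folklore] -/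
theorem moatH_mem_Icc (rA ΔG r : ℝ) : moatH rA ΔG r ∈ Icc 0 (1 / 2) := by
  unfold moatH; have h := smoothStep_mem_Icc rA (rA + ΔG) r
  constructor
  · linarith [h.2]
  · linarith [h.1]

/-- `H = 1/2` on `(-∞, r_A]`. [folklore] -/
theorem moatH_of_le (hΔ : 0 < ΔG) {r : ℝ} (hr : r ≤ rA) : moatH rA ΔG r = 1 / 2 := by
  unfold moatH; rw [smoothStep_of_le (by linarith) hr]; ring

/-- `H = 0` on `[r_A + Δ_G, ∞)`. [folklore] -/
theorem moatH_of_ge (hΔ : 0 < ΔG) {r : ℝ} (hr : rA + ΔG ≤ r) : moatH rA ΔG r = 0 := by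
  unfold moatH; rw [smoothStep_of_ge (by linarith) hr]; ring

/-- `H' = −step'/2`. [folklore] -/
theorem hasDerivAt_moatH (rA ΔG r : ℝ) :
    HasDerivAt (moatH rA ΔG) (-deriv (smoothStep rA (rA + ΔG)) r / 2) r := by
  unfold moatH
  have := (((differentiable_smoothStep rA (rA + ΔG) r).hasDerivAt).const_sub 1).div_const 2
  simpa using this

/-- `H' = 0` near a point `r < r_A`. [folklore] -/
theorem deriv_moatH_of_lt (hΔ : 0 < ΔG) {r : ℝ} (hr : r < rA) : deriv (moatH rA ΔG) r = 0 := by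
  rw [(hasDerivAt_moatH rA ΔG r).deriv, deriv_smoothStep_of_lt (by linarith) hr]; ring

/-- `H' = 0` beyond `r_A + Δ_G`. [folklore] -/
theorem deriv_moatH_of_gt (hΔ : 0 < ΔG) {r : ℝ} (hr : rA + ΔG < r) : deriv (moatH rA ΔG) r = 0 := by
  rw [(hasDerivAt_moatH rA ΔG r).deriv, deriv_smoothStep_of_gt (by linarith) hr]; ring

/-- **The moat bound** `|χ_w| = |2H + 2rH'| ≤ 1 + |r|·D_b/Δ_G`. [folklore] -/
theorem abs_chiW_le (hΔ : 0 < ΔG) (r : ℝ) :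
    |2 * moatH rA ΔG r + 2 * r * deriv (moatH rA ΔG) r| ≤ 1 + |r| * (stepD / ΔG) := by
  rw [(hasDerivAt_moatH rA ΔG r).deriv]
  have h := smoothStep_mem_Icc rA (rA + ΔG) r
  have hb := abs_deriv_smoothStep_le_stepD (show rA < rA + ΔG by linarith) r
  rw [show rA + ΔG - rA = ΔG by ring] at hb
  unfold moatH
  have e : 2 * ((1 - smoothStep rA (rA + ΔG) r) / 2) + 2 * r * (-deriv (smoothStep rA (rA + ΔG)) r / 2)
      = (1 - smoothStep rA (rA + ΔG) r) + -(r * deriv (smoothStep rA (rA + ΔG)) r) := by ring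
  rw [e]
  refine (abs_add_le _ _).trans (add_le_add ?_ ?_)
  · rw [abs_of_nonneg (by linarith [h.2])]; linarith [h.1]
  · rw [abs_neg, abs_mul]; exact mul_le_mul_of_nonneg_left hb (abs_nonneg _)

/-- The saturation `T(r) = (1 − s)r + s·r_C`, `s = step_{r_B}^{r_C}`. [folklore] -/
def satT (rB rC r : ℝ) : ℝ := (1 - smoothStep rB rC r) * r + smoothStep rB rC r * rC

/-- The final cut `cutE(r) = 1 − step_{r_E}^{r_E+Δ_E}(r)`. [folklore] -/
def cutE (rE ΔE r : ℝ) : ℝ := 1 - smoothStep rE (rE + ΔE) r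

/-- The cut saturation `T_E = T · cutE`. [folklore] -/
def satTE (rB rC rE ΔE r : ℝ) : ℝ := satT rB rC r * cutE rE ΔE r

/-- **The strain profile** `S(r) = ((1 − s) + s·r_C/r)·cutE(r)` (`= T_E/r` for `r > 0`, `= 1` for
`r ≤ r_B`); used for both `S` and `k`. [folklore] -/
def strainS (rB rC rE ΔE r : ℝ) : ℝ :=
  ((1 - smoothStep rB rC r) + smoothStep rB rC r * rC / r) * cutE rE ΔE r

/-- `T` is `C^∞`. [folklore] -/
theorem contDiff_satT (rB rC : ℝ) : ContDiff ℝ ∞ (satT rB rC) := by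
  unfold satT
  exact ((contDiff_const.sub (contDiff_smoothStep _ _)).mul contDiff_id).add
    ((contDiff_smoothStep _ _).mul contDiff_const)

/-- `cutE` is `C^∞`. [folklore] -/
theorem contDiff_cutE (rE ΔE : ℝ) : ContDiff ℝ ∞ (cutE rE ΔE) :=
  contDiff_const.sub (contDiff_smoothStep _ _)

/-- `T_E` is `C^∞`. [folklore] -/
theorem contDiff_satTE (rB rC rE ΔE : ℝ) : ContDiff ℝ ∞ (satTE rB rC rE ΔE) :=
  (contDiff_satT rB rC).mul (contDiff_cutE rE ΔE)

/-- `cutE ∈ [0, 1]`. [folklore] -/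
theorem cutE_mem_Icc (rE ΔE r : ℝ) : cutE rE ΔE r ∈ Icc 0 1 := by
  unfold cutE; have h := smoothStep_mem_Icc rE (rE + ΔE) r
  constructor <;> linarith [h.1, h.2]

/-- `cutE = 1` on `(-∞, r_E]`. [folklore] -/
theorem cutE_of_le (hΔ : 0 < ΔE) {r : ℝ} (hr : r ≤ rE) : cutE rE ΔE r = 1 := by
  unfold cutE; rw [smoothStep_of_le (by linarith) hr]; ring

/-- `cutE = 0` on `[r_E + Δ_E, ∞)`. [folklore] -/
theorem cutE_of_ge (hΔ : 0 < ΔE) {r : ℝ} (hr : rE + ΔE ≤ r) : cutE rE ΔE r = 0 := by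
  unfold cutE; rw [smoothStep_of_ge (by linarith) hr]; ring

/-- `cutE' = −step' ∈ [−D_b/Δ_E, 0]`. [folklore] -/
theorem hasDerivAt_cutE (rE ΔE r : ℝ) :
    HasDerivAt (cutE rE ΔE) (-deriv (smoothStep rE (rE + ΔE)) r) r := by
  unfold cutE
  simpa using ((differentiable_smoothStep rE (rE + ΔE) r).hasDerivAt).const_sub 1

/-- `T = r` on `(-∞, r_B]` (`r_B < r_C`). [folklore] -/
theorem satT_of_le (hBC : rB < rC) {r : ℝ} (hr : r ≤ rB) : satT rB rC r = r := by
  unfold satT; rw [smoothStep_of_le hBC hr]; ring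

/-- `T = r_C` on `[r_C, ∞)`. [folklore] -/
theorem satT_of_ge (hBC : rB < rC) {r : ℝ} (hr : rC ≤ r) : satT rB rC r = rC := by
  unfold satT; rw [smoothStep_of_ge hBC hr]; ring

/-- `0 ≤ T ≤ r_C` for `0 ≤ r` (`0 ≤ r_B < r_C`). [folklore] -/
theorem satT_mem_Icc (hB : 0 ≤ rB) (hBC : rB < rC) {r : ℝ} (hr : 0 ≤ r) :
    satT rB rC r ∈ Icc 0 rC := by
  have h := smoothStep_mem_Icc rB rC r
  rcases le_or_gt r rC with hle | hgt
  · unfold satT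
    constructor
    · nlinarith [h.1, h.2]
    · nlinarith [h.1, h.2]
  · rw [satT_of_ge hBC hgt.le]; constructor <;> linarith

/-- **`T' ≥ 0`**: `T' = (1 − s) + s'(r_C − r)` with both terms `≥ 0` on `r ≤ r_C`, and `T' = 0`
beyond. [folklore] -/
theorem hasDerivAt_satT (rB rC r : ℝ) :
    HasDerivAt (satT rB rC) ((1 - smoothStep rB rC r) + deriv (smoothStep rB rC) r * (rC - r)) r := by
  have hs := (differentiable_smoothStep rB rC r).hasDerivAt
  have h : HasDerivAt (satT rB rC) _ r := ((hs.const_sub 1).fun_mul (hasDerivAt_id r)).fun_add (hs.mul_const rC)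
  refine h.congr_deriv ?_
  simp only [id_eq]; ring

/-- `T' ≥ 0`. [folklore] -/
theorem deriv_satT_nonneg (hBC : rB < rC) (r : ℝ) : 0 ≤ deriv (satT rB rC) r := by
  rw [(hasDerivAt_satT rB rC r).deriv]
  have h := smoothStep_mem_Icc rB rC r
  rcases le_or_gt r rC with hle | hgt
  · have := deriv_smoothStep_nonneg hBC r
    nlinarith [h.2]
  · rw [deriv_smoothStep_of_gt hBC hgt, smoothStep_of_ge hBC hgt.le]; norm_num

/-- The derivative of `T_E` and its lower bound `T_E' ≥ −r_C·D_b/Δ_E` (`0 ≤ r`). [folklore] -/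
theorem deriv_satTE_ge (hB : 0 ≤ rB) (hBC : rB < rC) (hΔ : 0 < ΔE) {r : ℝ} (hr : 0 ≤ r) :
    -(rC * (stepD / ΔE)) ≤ deriv (satTE rB rC rE ΔE) r := by
  have hT := (contDiff_satT rB rC).differentiable (by simp) r |>.hasDerivAt
  have hc := hasDerivAt_cutE rE ΔE r
  have hd : HasDerivAt (satTE rB rC rE ΔE) _ r := hT.fun_mul hc
  rw [hd.deriv]
  have hT' := deriv_satT_nonneg hBC r
  have hTv := satT_mem_Icc hB hBC hr
  have hcv := cutE_mem_Icc rE ΔE r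
  have hs' : 0 ≤ deriv (smoothStep rE (rE + ΔE)) r := deriv_smoothStep_nonneg (by linarith) r
  have hsb := abs_deriv_smoothStep_le_stepD (show rE < rE + ΔE by linarith) r
  rw [show rE + ΔE - rE = ΔE by ring, abs_of_nonneg hs'] at hsb
  have hrC : 0 ≤ rC := by linarith
  nlinarith [mul_nonneg hT' hcv.1, mul_le_mul hTv.2 hsb hs' hrC]

/-- For `r ≤ r_E`: `T_E' = T' ≥ 0` (the cut is not active yet). [folklore] -/
theorem deriv_satTE_nonneg_of_lt (hBC : rB < rC) (hΔ : 0 < ΔE) {r : ℝ} (hr : r < rE) :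
    0 ≤ deriv (satTE rB rC rE ΔE) r := by
  have hloc : satTE rB rC rE ΔE =ᶠ[𝓝 r] satT rB rC := by
    filter_upwards [Iio_mem_nhds hr] with y hy
    unfold satTE; rw [cutE_of_le hΔ hy.le, mul_one]
  rw [hloc.deriv_eq]; exact deriv_satT_nonneg hBC r

/-- `0 ≤ T_E ≤ r_C` for `0 ≤ r`. [folklore] -/
theorem satTE_mem_Icc (hB : 0 ≤ rB) (hBC : rB < rC) {r : ℝ} (hr : 0 ≤ r) :
    satTE rB rC rE ΔE r ∈ Icc 0 rC := by
  unfold satTE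
  have hT := satT_mem_Icc hB hBC hr
  have hc := cutE_mem_Icc rE ΔE r
  constructor
  · exact mul_nonneg hT.1 hc.1
  · nlinarith [hT.1, hT.2, hc.1, hc.2]

/-- **`S = T_E/r` for `r > 0`.** [folklore] -/
theorem strainS_eq_div {r : ℝ} (hr : 0 < r) :
    strainS rB rC rE ΔE r = satTE rB rC rE ΔE r / r := by
  unfold strainS satTE satT
  field_simp

/-- **`S = 1` on `(−∞, r_B]` when `r_B ≤ r_E`** (`r_B < r_C`, `Δ_E > 0`). [folklore] -/
theorem strainS_of_le (hBC : rB < rC) (hBE : rB ≤ rE) (hΔ : 0 < ΔE) {r : ℝ} (hr : r ≤ rB) :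
    strainS rB rC rE ΔE r = 1 := by
  unfold strainS; rw [smoothStep_of_le hBC hr, cutE_of_le hΔ (hr.trans hBE)]; ring

/-- `S = 0` on `[r_E + Δ_E, ∞)`. [folklore] -/
theorem strainS_of_ge (hΔ : 0 < ΔE) {r : ℝ} (hr : rE + ΔE ≤ r) : strainS rB rC rE ΔE r = 0 := by
  unfold strainS; rw [cutE_of_ge hΔ hr, mul_zero]

/-- **`S` is `C^∞`** (`0 < r_B < r_C`, `r_B ≤ r_E`, `Δ_E > 0`): near points `r < r_B` it is the smooth
`cutE`, and on `r > 0` it is a product/quotient of smooth functions. [folklore] -/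
theorem contDiff_strainS (hB : 0 < rB) (hBC : rB < rC) (rE ΔE : ℝ) :
    ContDiff ℝ ∞ (strainS rB rC rE ΔE) := by
  refine contDiff_iff_contDiffAt.2 fun r => ?_
  rcases lt_or_ge r rB with hlt | hge
  · -- locally `S = cutE`
    have hloc : strainS rB rC rE ΔE =ᶠ[𝓝 r] cutE rE ΔE := by
      filter_upwards [Iio_mem_nhds hlt] with y hy
      unfold strainS; rw [smoothStep_of_le hBC hy.le]; ring
    exact ((contDiff_cutE rE ΔE).contDiffAt).congr_of_eventuallyEq hloc
  · have hr : 0 < r := by linarith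
    have hs : ContDiffAt ℝ ∞ (smoothStep rB rC) r := (contDiff_smoothStep rB rC).contDiffAt
    have hinv : ContDiffAt ℝ ∞ (fun y : ℝ => y⁻¹) r := contDiffAt_inv ℝ hr.ne'
    have h1 : ContDiffAt ℝ ∞ (fun y => (1 - smoothStep rB rC y) + smoothStep rB rC y * rC / y) r := by
      have : (fun y => (1 - smoothStep rB rC y) + smoothStep rB rC y * rC / y) =
          fun y => (1 - smoothStep rB rC y) + smoothStep rB rC y * rC * y⁻¹ := by
        funext y; rw [div_eq_mul_inv]
      rw [this]
      exact (contDiffAt_const.sub hs).add ((hs.mul contDiffAt_const).mul hinv)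
    exact h1.mul (contDiff_cutE rE ΔE).contDiffAt

/-- **The derivative of `S` on `r > 0`**: `S' = (T_E' r − T_E)/r²`. [folklore] -/
theorem hasDerivAt_strainS {r : ℝ} (hr : 0 < r) :
    HasDerivAt (strainS rB rC rE ΔE)
      ((deriv (satTE rB rC rE ΔE) r * r - satTE rB rC rE ΔE r) / r ^ 2) r := by
  have hloc : strainS rB rC rE ΔE =ᶠ[𝓝 r] fun y => satTE rB rC rE ΔE y / y := by
    filter_upwards [Ioi_mem_nhds hr] with y hy
    exact strainS_eq_div hy
  have hT := ((contDiff_satTE rB rC rE ΔE).differentiable (by simp) r).hasDerivAt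
  have hd := hT.div (hasDerivAt_id r) hr.ne'
  refine (hd.congr_of_eventuallyEq hloc).congr_deriv ?_
  simp

end Radial

end Literature.Geometry.Symplectic

end
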